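import Summits.Ventures.HSemireg.WedgeHankelSiegelIdealDiagonal

/-!
# Venture HSemireg — THE SIEGEL IDEAL (7): THE PER-BLOCK RANK LAW — on the Dolbeault block `H^b(⋀^a T)` (`k = a + b ≤ n`) the contraction with
# `v = Σ_j q_j Θ^j/j!` has rank `C(n,k)` if the window `(q_a, …, q_{a+n−k})` is non-zero (kernel = the isotropic part), and rank `0` otherwise

HONEST FRAMING. Part of the Lean index of the computation cell `pub-hsemireg` (seat p10 gen 11, Sunday typer «UNIFORM-IN-n»).
Finite-dimensional EXTERIOR ALGEBRA over a field ONLY; no variety, no cohomology theory, no sheaf, no Ext group, no semiregularity map;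
nothing here says that HC / HC_CM / HC_AV holds; no Literature fact is declared or used.  Custodian versions as in `WedgeHankelSiegelIdeal`
(1/3): FORMULA-N PART A §2.6 THEOREM H («rank(⌟v ∣ HT^k) = C(n,k)·rank H_k(v)»), §4.1″ (per-block / per-`q` laws); the dictionary
(`plane(a,b)` ↔ `H^b(⋀^a T)`, `θ ↦ θ ∧ w_n(q)` ↔ `⌟v`) is QUOTED, never asserted.

WHAT IS IN THE TREE / KEYED.  THEOREM H gives the rank on all of `HT^k`; the p10 per-`q` laws (`WedgeBoxPerQ*`, `WedgePointPairPowersPerQ*`)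
give block ranks for the PAIR classes only.  THIS FILE (continues namespace `Summit.Ventures.HSemireg.Wedge.HankelSiegelIdeal`; imports (6))
gives the block law for EVERY class on one factor:
* §10 LETTER-COUNT PROFILES (`cnt`, `Prof`): `w_m(q)` has one letter at each pair `< m` (`w_mem_Prof`), so `r_{S,i} ∧ w_n(q)` has two letters
  exactly on `S` (`rep_mul_w_mem_Prof`), whence **OFF-DIAGONAL VANISHING `coord_tgt_rep_mul_w_of_ne`**: its coordinate at the target
  monomial `tgt(S',T) = x_{univ∖T} y_{S'∪T}` of another `k`-set `S' ≠ S` is `0`.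
* **THE VANISHING HALF `plane_mul_w_eq_zero_of_window` / `wedgeP_eq_zero_of_window`: if `q_a = … = q_{a+n−k} = 0` then `θ ∧ w_n(q) = 0`
  for every `θ ∈ plane(a,b)`** (`w_n(q) = Σ_p q_p E_p`, `E_p ∈ plane(n−p,p)`, and `plane(a,b) ∧ plane(n−p,p) = 0` unless `a ≤ p ≤ a+n−k`).
* §12 **THE DIAGONAL `coord_tgt_rep_mul_w`: `coord_{tgt(S,T)}(r_{S,i} ∧ w_n(q)) = c·q_{(k−i)+|T|}`, `c ≠ 0`** ((6)'s `diag` at the role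
  assignment of `S ⊇ A`, `T`); `wedgeP` := `θ ↦ θ ∧ w_n(q)` on the plane; **`finrank_range_wedgeP_le`: rank `≤ C(n,a+b)` always**;
  **`finrank_range_wedgeP_of_window_ne`: rank `= C(n,a+b)` as soon as some `q_{a+s} ≠ 0`, `s ≤ n − k`** (the `C(n,k)` images `r_{S,b} ∧ w_n(q)`
  are independent: test against `tgt(S, T_S)`, `|T_S| = s`); **`ker_wedgeP_of_window_ne`: then the kernel on the block is EXACTLY its isotropic
  part `plane(a,b) ∩ SI_k`** (dimension `C(n,a)C(n,b) − C(n,k)`, (5)).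
So, class side and by value of the dictionary: on `H^b(⋀^a T)` the contraction with `v` is governed by ROW `a` of the catalecticant `H_k(q)`
(entries `q_a, …, q_{a+n−k}`): zero row ⇒ zero map; non-zero row ⇒ injective modulo the isotropic part.  Summing over the blocks recovers
THEOREM H's `C(n,k)·rank H_k(q)` only as an inequality (`rank H_k ≤ #non-zero rows`); the blocks' images overlap.  NOT typed: that overlap /
a per-block decomposition of THEOREM H's range; boxes; anything Ext-side.  Class side only.
-/

open Module

namespace Summit.Ventures.HSemireg.Wedge.HankelSiegelIdeal

open Summit.Ventures.HSemireg.Wedge Summit.Ventures.HSemireg.Wedge.Hankel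
  Summit.Ventures.HSemireg.Wedge.HankelSiegel

variable (K : Type*) [Field K] {n : ℕ}

/-! ## §10. Letter-count profiles: the images `r_{S,b} ∧ w_n(q)` for different `S` have disjoint monomial supports -/

/-- the number of letters (`0`, `1` or `2`) of a monomial support `s` at the pair `c`. -/
def cnt (s : Finset (In n)) (c : Fin n) : ℕ :=
  (if Fin.castAdd n c ∈ s then 1 else 0) + (if Fin.natAdd n c ∈ s then 1 else 0)

/-- the span of the monomials with a given letter-count profile. -/
noncomputable def Prof (φ : Fin n → ℕ) : Submodule K (HT K (In n)) :=
  Submodule.span K ((fun s => B K (In n) s) '' {s | cnt s = φ})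

/-- a coordinate at a monomial of the wrong profile vanishes. -/
lemma coord_eq_zero_of_mem_Prof {φ : Fin n → ℕ} {f : HT K (In n)} (hf : f ∈ Prof K φ) {t : Finset (In n)} (ht : cnt t ≠ φ) :
    (B K (In n)).coord t f = 0 := by
  induction hf using Submodule.span_induction with
  | mem x hx =>
    obtain ⟨s, hs, rfl⟩ := hx
    rw [Basis.coord_apply, Basis.repr_self, Finsupp.single_apply, if_neg]
    rintro rfl; exact ht hs
  | zero => rw [map_zero]
  | add x y _ _ hx hy => rw [map_add, hx, hy, add_zero]
  | smul c x _ hx => rw [map_smul, hx, smul_zero]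

/-- letter counts add over disjoint supports. -/
lemma cnt_union {s t : Finset (In n)} (h : Disjoint s t) : cnt (s ∪ t) = cnt s + cnt t := by
  funext c
  simp only [cnt, Finset.mem_union, Pi.add_apply]
  have hx : ¬ (Fin.castAdd n c ∈ s ∧ Fin.castAdd n c ∈ t) := fun h' => Finset.disjoint_left.mp h h'.1 h'.2
  have hy : ¬ (Fin.natAdd n c ∈ s ∧ Fin.natAdd n c ∈ t) := fun h' => Finset.disjoint_left.mp h h'.1 h'.2
  by_cases a1 : Fin.castAdd n c ∈ s <;> by_cases a2 : Fin.castAdd n c ∈ t <;>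
    by_cases b1 : Fin.natAdd n c ∈ s <;> by_cases b2 : Fin.natAdd n c ∈ t <;> simp_all

/-- `Prof φ ∧ E_t ⊆ Prof (φ + cnt t)`. -/
lemma mul_B_mem_Prof {φ : Fin n → ℕ} {f : HT K (In n)} (hf : f ∈ Prof K φ) (t : Finset (In n)) :
    f * B K (In n) t ∈ Prof K (φ + cnt t) := by
  induction hf using Submodule.span_induction with
  | mem x hx =>
    obtain ⟨s, hs, rfl⟩ := hx
    rw [B_mul_B]
    by_cases hst : Disjoint s t
    · exact Submodule.smul_mem _ _ (Submodule.subset_span ⟨s ∪ t, by rw [Set.mem_setOf_eq, cnt_union hst, hs], rfl⟩)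
    · rw [u_eq_zero K hst, zero_smul]; exact Submodule.zero_mem _
  | zero => rw [zero_mul]; exact Submodule.zero_mem _
  | add x y _ _ hx hy => rw [add_mul]; exact Submodule.add_mem _ hx hy
  | smul c x _ hx => rw [smul_mul_assoc]; exact Submodule.smul_mem _ _ hx

/-- `E_t ∧ Prof φ ⊆ Prof (cnt t + φ)`. -/
lemma B_mul_mem_Prof {φ : Fin n → ℕ} {f : HT K (In n)} (hf : f ∈ Prof K φ) (t : Finset (In n)) :
    B K (In n) t * f ∈ Prof K (cnt t + φ) := by
  induction hf using Submodule.span_induction with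
  | mem x hx =>
    obtain ⟨s, hs, rfl⟩ := hx
    rw [B_mul_B]
    by_cases hst : Disjoint t s
    · exact Submodule.smul_mem _ _ (Submodule.subset_span ⟨t ∪ s, by rw [Set.mem_setOf_eq, cnt_union hst, hs], rfl⟩)
    · rw [u_eq_zero K hst, zero_smul]; exact Submodule.zero_mem _
  | zero => rw [mul_zero]; exact Submodule.zero_mem _
  | add x y _ _ hx hy => rw [mul_add]; exact Submodule.add_mem _ hx hy
  | smul c x _ hx => rw [mul_smul_comm]; exact Submodule.smul_mem _ _ hx

/-- the profile of `xs P ∪ ys Q`. -/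
lemma cnt_xs_union_ys (P Q : Finset (Fin n)) :
    cnt (xs P ∪ ys Q) = fun c => (if c ∈ P then 1 else 0) + (if c ∈ Q then 1 else 0) := by
  funext c
  simp only [cnt, Finset.mem_union, castAdd_mem_xs, natAdd_mem_ys, castAdd_notMem_ys, natAdd_notMem_xs, or_false, false_or]

/-- **th-7's class has exactly one letter at each of the first `m` pairs: `w_m(q) ∈ Prof(1_{[0,m)})`.** -/
theorem w_mem_Prof {m : ℕ} (hm : m ≤ n) (q : ℕ → K) : w K n m q ∈ Prof K (fun c => if (c : ℕ) < m then 1 else 0) := by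
  induction m generalizing q with
  | zero =>
    rw [w, ← B_empty K]
    refine Submodule.smul_mem _ _ (Submodule.subset_span ⟨∅, ?_, rfl⟩)
    rw [Set.mem_setOf_eq]; funext c; simp [cnt]
  | succ m ih =>
    have hmn : m < n := by omega
    have hX : X K n m = B K (In n) (xs {(⟨m, hmn⟩ : Fin n)} ∪ ys ∅) := by
      rw [show X K n m = X K n ((⟨m, hmn⟩ : Fin n) : ℕ) from rfl, X_eq_gx, gx]
      simp [xs, ys]
    have hY : Y K n m = B K (In n) (xs ∅ ∪ ys {(⟨m, hmn⟩ : Fin n)}) := by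
      rw [show Y K n m = Y K n ((⟨m, hmn⟩ : Fin n) : ℕ) from rfl, Y_eq_gx, gx]
      simp [xs, ys]
    have e1 : ((fun c : Fin n => if (c : ℕ) < m then 1 else 0) + cnt (xs {(⟨m, hmn⟩ : Fin n)} ∪ ys ∅)) =
        fun c : Fin n => if (c : ℕ) < m + 1 then 1 else 0 := by
      funext c; rw [cnt_xs_union_ys]; simp only [Pi.add_apply, Finset.mem_singleton, Finset.notMem_empty, if_false, add_zero, Fin.ext_iff]
      split_ifs <;> omega
    have e2 : ((fun c : Fin n => if (c : ℕ) < m then 1 else 0) + cnt (xs ∅ ∪ ys {(⟨m, hmn⟩ : Fin n)})) =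
        fun c : Fin n => if (c : ℕ) < m + 1 then 1 else 0 := by
      funext c; rw [cnt_xs_union_ys]; simp only [Pi.add_apply, Finset.mem_singleton, Finset.notMem_empty, if_false, zero_add, Fin.ext_iff]
      split_ifs <;> omega
    rw [w]
    refine Submodule.add_mem _ ?_ ?_
    · have h := mul_B_mem_Prof K (ih (by omega) q) (xs {(⟨m, hmn⟩ : Fin n)} ∪ ys ∅)
      rw [← hX, e1] at h; exact h
    · have h := mul_B_mem_Prof K (ih (by omega) (shift K q)) (xs ∅ ∪ ys {(⟨m, hmn⟩ : Fin n)})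
      rw [← hY, e2] at h; exact h

/-- **`r_{S,i} ∧ w_n(q)` has two letters at the pairs of `S` and one letter elsewhere.** -/
theorem rep_mul_w_mem_Prof {k : ℕ} (p : RIdx n k) (q : ℕ → K) :
    rep K p * w K n n q ∈ Prof K (fun c => (if c ∈ p.1.1 then 1 else 0) + 1) := by
  obtain ⟨c₀, -, hc₀⟩ := rep_eq_smul_B K p
  have hw := w_mem_Prof K (n := n) le_rfl q
  have e : (fun c : Fin n => if (c : ℕ) < n then (1 : ℕ) else 0) = fun _ => 1 := funext fun c => if_pos c.2
  rw [e] at hw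
  have h := B_mul_mem_Prof K hw (xs (p.1.1 \ canon p.1.1 p.2) ∪ ys (canon p.1.1 p.2))
  have e' : (cnt (xs (p.1.1 \ canon p.1.1 p.2) ∪ ys (canon p.1.1 p.2)) + fun _ : Fin n => 1) =
      fun c => (if c ∈ p.1.1 then 1 else 0) + 1 := by
    funext c
    rw [Pi.add_apply, cnt_xs_union_ys]
    have hA := canon_subset p.1.1 p.2
    by_cases h1 : c ∈ p.1.1
    · by_cases h2 : c ∈ canon p.1.1 p.2 <;> simp [h1, h2, Finset.mem_sdiff]
    · have h2 : c ∉ canon p.1.1 p.2 := fun h => h1 (hA h)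
      simp [h1, h2, Finset.mem_sdiff]
  rw [e'] at h
  rw [hc₀, smul_mul_assoc]
  exact Submodule.smul_mem _ _ h

/-- the TARGET MONOMIAL of `S` and `T ⊆ Sᶜ`: `x`-letters off `T`, `y`-letters on `S ∪ T` (the product of `x_{S∖A} y_A` with the term `T ⊔ (S∖A)` of `E_{a+|T|}`). -/
def tgt (S T : Finset (Fin n)) : Finset (In n) := xs (Finset.univ \ T) ∪ ys (S ∪ T)

/-- the profile of the target monomial: two letters on `S`, one elsewhere. -/
lemma cnt_tgt {S T : Finset (Fin n)} (hST : Disjoint S T) : cnt (tgt S T) = fun c => (if c ∈ S then 1 else 0) + 1 := by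
  funext c
  rw [tgt, cnt_xs_union_ys]
  simp only [Finset.mem_sdiff, Finset.mem_univ, true_and, Finset.mem_union]
  by_cases h1 : c ∈ S <;> by_cases h2 : c ∈ T <;> simp [h1, h2]
  exact Finset.disjoint_left.mp hST h1 h2

/-- **OFF-DIAGONAL VANISHING: the coordinate of `r_{S',i} ∧ w_n(q)` at the target monomial of `S ≠ S'` is zero** (wrong profile). -/
theorem coord_tgt_rep_mul_w_of_ne {k : ℕ} (p : RIdx n k) {S T : Finset (Fin n)} (hST : Disjoint S T) (hne : p.1.1 ≠ S) (q : ℕ → K) :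
    (B K (In n)).coord (tgt S T) (rep K p * w K n n q) = 0 := by
  apply coord_eq_zero_of_mem_Prof K (rep_mul_w_mem_Prof K p q)
  rw [cnt_tgt hST]
  intro h
  apply hne
  ext c
  have := congrFun h c
  by_cases h1 : c ∈ S <;> by_cases h2 : c ∈ p.1.1 <;> simp [h1, h2] at this ⊢

/-! ## §9 (continued). The vanishing half of the per-block law -/

/-- **THE VANISHING HALF OF THE PER-BLOCK LAW: if the window `q_a, …, q_{a+n−k}` of the class vanishes (`k = a + b ≤ n`), then
`θ ∧ w_n(q) = 0` for EVERY `θ` in the `(a,b)`-plane** (`w_n(q) = Σ_p q_p E_p`, `E_p ∈ plane(n−p, p)`, and `plane(a,b) ∧ plane(n−p,p) = 0`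
unless `a ≤ p ≤ a + n − k`). -/
theorem plane_mul_w_eq_zero_of_window {a b : ℕ} (hk : a + b ≤ n) {q : ℕ → K} (hq : ∀ s, s ≤ n - (a + b) → q (a + s) = 0)
    {θ : HT K (In n)} (hθ : θ ∈ plane K n a b) : θ * w K n n q = 0 := by
  rw [w_eq_sum_spikes, Finset.mul_sum]
  apply Finset.sum_eq_zero
  intro p hp
  rw [Finset.mem_range] at hp
  rw [mul_smul_comm]
  by_cases h1 : p < a
  · rw [mul_eq_zero_of_mem_plane K (Or.inl (by omega)) hθ (w_spike_mem_plane K le_rfl (by omega)), smul_zero]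
  · by_cases h2 : n - b < p
    · rw [mul_eq_zero_of_mem_plane K (Or.inr (by omega)) hθ (w_spike_mem_plane K le_rfl (by omega)), smul_zero]
    · obtain ⟨s, rfl⟩ : ∃ s, p = a + s := ⟨p - a, by omega⟩
      rw [hq s (by omega), zero_smul]

/-- the same, kernel form: **the whole `(a,b)`-plane lies in `ker(θ ↦ θ ∧ w_n(q) ∣ ⋀^k)` when the window vanishes.** -/
theorem plane_le_ker_of_window {a b : ℕ} (hk : a + b ≤ n) {q : ℕ → K} (hq : ∀ s, s ≤ n - (a + b) → q (a + s) = 0) :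
    (plane K n a b).comap (⋀[K]^(a + b) (In n → K)).subtype ≤ LinearMap.ker (Hankel.wedge K n (a + b) (w K n n q)) := by
  intro θ hθ
  rw [LinearMap.mem_ker, Hankel.wedge, LinearMap.comp_apply, Submodule.subtype_apply, LinearMap.mulRight_apply]
  exact plane_mul_w_eq_zero_of_window K hk hq hθ

/-! ## §12. THE PER-BLOCK RANK LAW on the `(a,b)`-plane: rank `C(n, a+b)` if the window `(q_a, …, q_{a+n−k})` is non-zero, `0` otherwise -/

/-- the role assignment of a standard monomial `x_{S∖A} ∧ y_A` and an extra `y`-set `T`. -/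
def roleOf (S A T : Finset (Fin n)) : Fin n → ℕ := fun c => if c ∈ S \ A then 0 else if c ∈ A then 1 else if c ∈ T then 2 else 3

omit [Field K] in
/-- role `0` ⟺ `c ∈ S ∖ A`. -/
lemma roleOf_eq_zero_iff (S A T : Finset (Fin n)) (c : Fin n) : roleOf S A T c = 0 ↔ c ∈ S \ A := by
  unfold roleOf
  split_ifs with h1 h2 h3
  · exact ⟨fun _ => h1, fun _ => rfl⟩
  · exact ⟨fun h => absurd h (by decide), fun h => (h1 h).elim⟩
  · exact ⟨fun h => absurd h (by decide), fun h => (h1 h).elim⟩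
  · exact ⟨fun h => absurd h (by decide), fun h => (h1 h).elim⟩

omit [Field K] in
/-- role `1` ⟺ `c ∈ A` (for `A ⊆ S`). -/
lemma roleOf_eq_one_iff {S A : Finset (Fin n)} (T : Finset (Fin n)) (c : Fin n) : roleOf S A T c = 1 ↔ c ∈ A := by
  unfold roleOf
  split_ifs with h1 h2 h3
  · exact ⟨fun h => absurd h (by decide), fun h => ((Finset.mem_sdiff.mp h1).2 h).elim⟩
  · exact ⟨fun _ => h2, fun _ => rfl⟩
  · exact ⟨fun h => absurd h (by decide), fun h => (h2 h).elim⟩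
  · exact ⟨fun h => absurd h (by decide), fun h => (h2 h).elim⟩

omit [Field K] in
/-- role `2` ⟺ `c ∈ T` (for `A ⊆ S` and `T` disjoint from `S`). -/
lemma roleOf_eq_two_iff {S A T : Finset (Fin n)} (hA : A ⊆ S) (hT : Disjoint S T) (c : Fin n) : roleOf S A T c = 2 ↔ c ∈ T := by
  unfold roleOf
  split_ifs with h1 h2 h3
  · exact ⟨fun h => absurd h (by decide), fun h => (Finset.disjoint_left.mp hT (Finset.mem_sdiff.mp h1).1 h).elim⟩
  · exact ⟨fun h => absurd h (by decide), fun h => (Finset.disjoint_left.mp hT (hA h2) h).elim⟩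
  · exact ⟨fun _ => h3, fun _ => rfl⟩
  · exact ⟨fun h => absurd h (by decide), fun h => (h3 h).elim⟩

omit [Field K] in
/-- role `≤ 2` ⟺ `c ∈ S ∪ T` (for `A ⊆ S`, `T` disjoint from `S`). -/
lemma roleOf_le_two_iff {S A T : Finset (Fin n)} (hA : A ⊆ S) (c : Fin n) : roleOf S A T c ≤ 2 ↔ c ∈ S ∪ T := by
  unfold roleOf
  rw [Finset.mem_union]
  split_ifs with h1 h2 h3
  · exact ⟨fun _ => Or.inl (Finset.mem_sdiff.mp h1).1, fun _ => by decide⟩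
  · exact ⟨fun _ => Or.inl (hA h2), fun _ => by decide⟩
  · exact ⟨fun _ => Or.inr h3, fun _ => le_rfl⟩
  · refine ⟨fun h => absurd h (by decide), fun h => ?_⟩
    rcases h with h | h
    · exact (h1 (Finset.mem_sdiff.mpr ⟨h, h2⟩)).elim
    · exact (h3 h).elim

omit [Field K] in
/-- role `0` = `S ∖ A` at the top. -/
lemma rset_roleOf_zero (S A T : Finset (Fin n)) : rset (roleOf S A T) n 0 = S \ A := by
  ext c
  rw [rset, Finset.mem_filter, roleOf_eq_zero_iff]
  exact ⟨fun h => h.2.2, fun h => ⟨Finset.mem_univ _, c.2, h⟩⟩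

omit [Field K] in
/-- role `1` = `A` at the top. -/
lemma rset_roleOf_one (S A T : Finset (Fin n)) : rset (roleOf S A T) n 1 = A := by
  ext c
  rw [rset, Finset.mem_filter, roleOf_eq_one_iff]
  exact ⟨fun h => h.2.2, fun h => ⟨Finset.mem_univ _, c.2, h⟩⟩

omit [Field K] in
/-- role `2` = `T` at the top. -/
lemma rset_roleOf_two {S A T : Finset (Fin n)} (hA : A ⊆ S) (hT : Disjoint S T) : rset (roleOf S A T) n 2 = T := by
  ext c
  rw [rset, Finset.mem_filter, roleOf_eq_two_iff hA hT]
  exact ⟨fun h => h.2.2, fun h => ⟨Finset.mem_univ _, c.2, h⟩⟩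

omit [Field K] in
/-- the target monomial of the role assignment is `tgt S T`. -/
lemma Mr_roleOf {S A T : Finset (Fin n)} (hA : A ⊆ S) (hT : Disjoint S T) : Mr (roleOf S A T) n = tgt S T := by
  have hx : (Finset.univ.filter fun c : Fin n => (c : ℕ) < n ∧ roleOf S A T c ≠ 2) = Finset.univ \ T := by
    ext c
    rw [Finset.mem_filter, Ne, roleOf_eq_two_iff hA hT, Finset.mem_sdiff]
    exact ⟨fun h => ⟨h.1, h.2.2⟩, fun h => ⟨h.1, c.2, h.2⟩⟩
  have hy : (Finset.univ.filter fun c : Fin n => (c : ℕ) < n ∧ roleOf S A T c ≤ 2) = S ∪ T := by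
    ext c
    rw [Finset.mem_filter, roleOf_le_two_iff hA]
    exact ⟨fun h => h.2.2, fun h => ⟨Finset.mem_univ _, c.2, h⟩⟩
  rw [Mr, tgt, hx, hy]

/-- **THE DIAGONAL COEFFICIENT: `coord_{tgt(S,T)}(r_{S,i} ∧ w_n(q)) = c · q_{(k−i)+|T|}` with `c ≠ 0`, for every `T` disjoint from `S` and EVERY `q`.** -/
theorem coord_tgt_rep_mul_w {k : ℕ} (p : RIdx n k) {T : Finset (Fin n)} (hT : Disjoint p.1.1 T) :
    ∃ c : K, c ≠ 0 ∧ ∀ q : ℕ → K, (B K (In n)).coord (tgt p.1.1 T) (rep K p * w K n n q) = c * q ((k - p.2) + T.card) := by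
  obtain ⟨⟨S, hS⟩, i⟩ := p
  have hi : (i : ℕ) ≤ S.card := by rw [hS]; have := i.2; omega
  have hA := canon_subset S i
  obtain ⟨c₀, hc₀, h₀⟩ := rep_eq_smul_B K ((⟨S, hS⟩, i) : RIdx n k)
  obtain ⟨c, hc, h⟩ := diag K (ρ := roleOf S (canon S i) T) (m := n) le_rfl
  have e1 : θr K (roleOf S (canon S i) T) n = B K (In n) (xs (S \ canon S i) ∪ ys (canon S i)) := by
    rw [θr, rset_roleOf_zero, rset_roleOf_one]
  have e2 : Mr (roleOf S (canon S i) T) n = tgt S T := Mr_roleOf hA hT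
  have e3 : vr (roleOf S (canon S i) T) n = (k - i) + T.card := by
    rw [vr, rset_roleOf_zero, rset_roleOf_two hA hT, Finset.card_sdiff_of_subset hA, hS, card_canon hi]
  refine ⟨c₀ * c, mul_ne_zero hc₀ hc, fun q => ?_⟩
  simp only at h₀ ⊢
  rw [h₀, smul_mul_assoc, map_smul, ← e1, ← e2, h q, e3, smul_eq_mul, mul_assoc]

/-- `θ ↦ θ ∧ w_n(q)` restricted to the `(a,b)`-plane (dictionary: the contraction `⌟v` on the Dolbeault block `H^b(⋀^a T)`). -/
noncomputable def wedgeP (n a b : ℕ) (q : ℕ → K) : plane K n a b →ₗ[K] HT K (In n) :=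
  LinearMap.mulRight K (w K n n q) ∘ₗ (plane K n a b).subtype

/-- the isotropic part of the plane is always in the kernel. -/
lemma comap_siegelIdeal_le_ker_wedgeP (a b : ℕ) (q : ℕ → K) :
    (siegelIdeal K n (a + b)).comap (plane K n a b).subtype ≤ LinearMap.ker (wedgeP K n a b q) := by
  intro θ hθ
  rw [LinearMap.mem_ker, wedgeP, LinearMap.comp_apply, Submodule.subtype_apply, LinearMap.mulRight_apply]
  exact mul_w_eq_zero_of_mem_siegelIdeal K hθ q

/-- dimension of the isotropic part, comap form. -/
lemma finrank_comap_plane_siegelIdeal (a b : ℕ) :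
    finrank K ((siegelIdeal K n (a + b)).comap (plane K n a b).subtype) + n.choose (a + b) = n.choose a * n.choose b := by
  rw [← finrank_plane_inf_siegelIdeal K (n := n) a b, ← Submodule.map_comap_subtype, Submodule.finrank_map_subtype_eq]

/-- **ON EVERY BLOCK THE RANK IS AT MOST `C(n, a+b)`** (the isotropic part has codimension `C(n, a+b)` in the plane). -/
theorem finrank_range_wedgeP_le (a b : ℕ) (q : ℕ → K) : finrank K (LinearMap.range (wedgeP K n a b q)) ≤ n.choose (a + b) := by
  have h1 := LinearMap.finrank_range_add_finrank_ker (wedgeP K n a b q)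
  have h2 := Submodule.finrank_mono (comap_siegelIdeal_le_ker_wedgeP K (n := n) a b q)
  have h3 := finrank_comap_plane_siegelIdeal K (n := n) a b
  rw [finrank_plane] at h1
  omega

/-- **ZERO WINDOW ⇒ RANK `0`: if `q_a = … = q_{a+n−k} = 0` (`k = a + b ≤ n`) the block map vanishes identically.** -/
theorem wedgeP_eq_zero_of_window {a b : ℕ} (hk : a + b ≤ n) {q : ℕ → K} (hq : ∀ s, s ≤ n - (a + b) → q (a + s) = 0) :
    wedgeP K n a b q = 0 := by
  ext θ
  rw [wedgeP, LinearMap.comp_apply, Submodule.subtype_apply, LinearMap.mulRight_apply, LinearMap.zero_apply]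
  exact plane_mul_w_eq_zero_of_window K hk hq θ.2

/-- **NON-ZERO WINDOW ⇒ FULL RANK `C(n, a+b)`: if some `q_{a+s} ≠ 0` (`s ≤ n − k`) then the images `r_{S,b} ∧ w_n(q)`, `|S| = k`, are
linearly independent** (diagonal coefficients `c_S · q_{a+s} ≠ 0` at the target monomials `tgt(S, T_S)`, `|T_S| = s`, off-diagonal `0`). -/
theorem finrank_range_wedgeP_of_window_ne {a b : ℕ} {q : ℕ → K} {s : ℕ} (hs : s ≤ n - (a + b)) (hq : q (a + s) ≠ 0) :
    finrank K (LinearMap.range (wedgeP K n a b q)) = n.choose (a + b) := by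
  apply le_antisymm (finrank_range_wedgeP_le K a b q)
  let f : {S : Finset (Fin n) // S.card = a + b} → LinearMap.range (wedgeP K n a b q) := fun S =>
    ⟨rep K ((S, ⟨b, by omega⟩) : RIdx n (a + b)) * w K n n q, ⟨⟨_, rep_mem_plane K S⟩, rfl⟩⟩
  have hf : LinearIndependent K f := by
    apply LinearIndependent.of_comp (LinearMap.range (wedgeP K n a b q)).subtype
    rw [linearIndependent_iff']
    intro t g hsum S₀ hS₀
    -- the test set T₀ ⊆ S₀ᶜ with |T₀| = s
    have hTc : s ≤ (Finset.univ \ S₀.1).card := by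
      rw [Finset.card_sdiff_of_subset (Finset.subset_univ _), Finset.card_univ, Fintype.card_fin, S₀.2]; omega
    have hT₀ : Disjoint S₀.1 (canon (Finset.univ \ S₀.1) s) :=
      Finset.disjoint_of_subset_right (canon_subset _ _) Finset.disjoint_sdiff
    obtain ⟨c, hc, hcq⟩ := coord_tgt_rep_mul_w K ((S₀, ⟨b, by omega⟩) : RIdx n (a + b)) hT₀
    have h := congrArg ((B K (In n)).coord (tgt S₀.1 (canon (Finset.univ \ S₀.1) s))) hsum
    rw [map_sum, map_zero, Finset.sum_eq_single S₀] at h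
    · rw [Function.comp_apply, Submodule.subtype_apply, map_smul, hcq, card_canon hTc, smul_eq_mul,
        show a + b - (b : ℕ) + s = a + s by omega] at h
      exact (mul_eq_zero.mp h).resolve_right (mul_ne_zero hc hq)
    · intro S _ hne
      rw [Function.comp_apply, Submodule.subtype_apply, map_smul,
        coord_tgt_rep_mul_w_of_ne K ((S, ⟨b, by omega⟩) : RIdx n (a + b)) hT₀ (fun h => hne (Subtype.ext h)), smul_zero]
    · intro h; exact absurd hS₀ h
  have := hf.fintype_card_le_finrank
  rwa [Fintype.card_finset_len, Fintype.card_fin] at this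

/-- **… AND THEN THE KERNEL ON THE BLOCK IS EXACTLY ITS ISOTROPIC PART `plane(a,b) ∩ SI_k`.** -/
theorem ker_wedgeP_of_window_ne {a b : ℕ} {q : ℕ → K} {s : ℕ} (hs : s ≤ n - (a + b)) (hq : q (a + s) ≠ 0) :
    LinearMap.ker (wedgeP K n a b q) = (siegelIdeal K n (a + b)).comap (plane K n a b).subtype := by
  symm
  apply Submodule.eq_of_le_of_finrank_eq (comap_siegelIdeal_le_ker_wedgeP K a b q)
  have h1 := LinearMap.finrank_range_add_finrank_ker (wedgeP K n a b q)
  rw [finrank_plane, finrank_range_wedgeP_of_window_ne K hs hq] at h1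
  have h3 := finrank_comap_plane_siegelIdeal K (n := n) a b
  omega


end Summit.Ventures.HSemireg.Wedge.HankelSiegelIdeal
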